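import Literature.NumberTheory.EllipticCurves.CanonicalPAdicHeightParallelogramProofs
import HarnessLib

/-!
# Route `ByReductionTypeAtTwo`, crux `RankOneAtTwoBigImageOddLocal` (item stmt-BirchSwinnertonDyer-23715), line AN62, σ₀-LEMMA BLOCK
# (cell `bsd-f1-sign2`, planner seat `-an` g50; `--supports 23715`, helper):
# **NÉRON'S DUPLICATION NUMERATOR: for a rational point with non-singular reduction at every prime, `num x(2P)` is EXACTLY
# `a⁴ − b₄a²D² − 2b₆aD³ − b₈D⁴` (`x(P) = a/D` in lowest terms) — no cancellation**

HONEST FRAMING (D-0036/D-0054): THEOREMS ONLY (no definition, no named fact, no `sorry`, no instance).  `V/ℚ` a `ℤ`-integral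
Weierstrass equation (any `a₁`).  For `P = (x, y)` with `x = a/D` in lowest terms and `2P = (x′, y′)` affine, the duplication formula
reads `x′ = φ₂(x)/ψ₂(x)²`, `φ₂ = x⁴ − b₄x² − 2b₆x − b₈`, `ψ₂² = (2y + a₁x + a₃)² = 4x³ + b₂x² + 2b₄x + b₆`, i.e. `x′ = N/M` with the
INTEGERS `N = a⁴ − b₄a²D² − 2b₆aD³ − b₈D⁴`, `M = D⁴ψ₂² = D(4a³ + b₂a²D + 2b₄aD² + b₆D³) > 0`.  If `P` has non-singular reduction at
every prime (tree `HasNonsingularReductionAt`: `v_ℓ(x) < 0`, or `Φ_x(P)` or `Φ_y(P)` an `ℓ`-adic unit) then `gcd(N, M) = 1`: a prime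
`ℓ ∣ D` dividing `N ≡ a⁴ (mod D)` would divide `a`; a prime `ℓ ∤ D` dividing `M` and `N` makes `ψ₂ = Φ_y(P)` and — through the identity
`φ₂ = Φ_x² − a₁Φ_xψ₂ − (a₂ + 2x)ψ₂²` on the curve — `Φ_x(P)` non-units, while `v_ℓ(x) ≥ 0`.  Hence `num x′ = N` on the nose
(`num_two_nsmul_eq_neronNumerator`).  This is the typed candidate 54D `NeronDuplicationNumerator` of the workfile
`Cruxes/RankOneAtTwoBigImageOddLocal/WildPairHeightAN62.lean` §13.5 (census 10 890/10 890, CensusAN56), the last hypothesis of the level-one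
law 54B for the `η`-height.  Nothing here is a statement about `BSDp`; item 23715 stays OPEN; BSD is proved for no curve.

PLACEMENT: in print (Ayad 1992, «Points S-entiers des courbes elliptiques», Manuscripta Math. 76, Lemme 3.x: `P mod ℓ` singular iff
`ℓ ∣ gcd(φ̂_m, ψ̂_m)`; Wuthrich 2004 §2; Silverman AEC Ex. 3.7) ∘ kernel.  References: [cite: SilvermanAEC2009, III.2.3(d), Ex. 3.7, VII.2]
[cite: MazurSteinTate2006, §1 («denominator»)].
-/

set_option autoImplicit false

noncomputable section

open scoped Classical

open WeierstrassCurve Literature Literature.NumberTheory.EllipticCurves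

namespace Summit.BirchSwinnertonDyer.BirchSwinnertonDyer.Theorems

namespace NaiveSigmaLogAtTwo

/-! ### §9.1 The duplication formula as `φ₂/ψ₂²` (any field) -/

section Field

variable {F : Type*} [Field F] (W : WeierstrassCurve.Affine F)

/-- `ψ₂² = (2y + a₁x + a₃)² = 4x³ + b₂x² + 2b₄x + b₆` on the curve. [cite: SilvermanAEC2009, III.2.3(d)] -/
theorem psiTwo_sq_eq {x y : F} (heq : W.Equation x y) :
    (2 * y + W.a₁ * x + W.a₃) ^ 2 = 4 * x ^ 3 + W.b₂ * x ^ 2 + 2 * W.b₄ * x + W.b₆ := by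
  rw [WeierstrassCurve.Affine.equation_iff] at heq
  rw [WeierstrassCurve.b₂, WeierstrassCurve.b₄, WeierstrassCurve.b₆]
  linear_combination 4 * heq

/-- The duplication numerator on the curve: `Φ² + a₁Φψ₂ − (a₂ + 2x)ψ₂² = φ₂(x) = x⁴ − b₄x² − 2b₆x − b₈`, where `Φ = 3x² + 2a₂x + a₄ − a₁y`
is the numerator of the tangent slope and `ψ₂ = 2y + a₁x + a₃` its denominator. [cite: SilvermanAEC2009, III.2.3(d)] -/
theorem dupNumerator_eq {x y : F} (heq : W.Equation x y) :
    (3 * x ^ 2 + 2 * W.a₂ * x + W.a₄ - W.a₁ * y) ^ 2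
        + W.a₁ * (3 * x ^ 2 + 2 * W.a₂ * x + W.a₄ - W.a₁ * y) * (2 * y + W.a₁ * x + W.a₃)
        - (W.a₂ + 2 * x) * (2 * y + W.a₁ * x + W.a₃) ^ 2
      = x ^ 4 - W.b₄ * x ^ 2 - 2 * W.b₆ * x - W.b₈ := by
  rw [WeierstrassCurve.Affine.equation_iff] at heq
  rw [WeierstrassCurve.b₄, WeierstrassCurve.b₆, WeierstrassCurve.b₈]
  linear_combination (-(8 * x + W.a₁ ^ 2 + 4 * W.a₂)) * heq

/-- **The duplication formula**: for `P = (x, y)` on the curve with `P ≠ −P`, `x(2P) = φ₂(x) / ψ₂²`.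
[cite: SilvermanAEC2009, III.2.3(d)] -/
theorem addX_self_eq_div [DecidableEq F] {x y : F} (heq : W.Equation x y) (hy : y ≠ W.negY x y) :
    W.addX x x (W.slope x x y y) = (x ^ 4 - W.b₄ * x ^ 2 - 2 * W.b₆ * x - W.b₈) / (2 * y + W.a₁ * x + W.a₃) ^ 2 := by
  have hψ : 2 * y + W.a₁ * x + W.a₃ ≠ 0 := by
    intro h0; apply hy; rw [WeierstrassCurve.Affine.negY]; linear_combination h0
  have e : y - W.negY x y = 2 * y + W.a₁ * x + W.a₃ := by rw [WeierstrassCurve.Affine.negY]; ring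
  have hL : W.slope x x y y * (2 * y + W.a₁ * x + W.a₃) = 3 * x ^ 2 + 2 * W.a₂ * x + W.a₄ - W.a₁ * y := by
    rw [WeierstrassCurve.Affine.slope_of_Y_ne rfl hy, e]; exact div_mul_cancel₀ _ hψ
  rw [WeierstrassCurve.Affine.addX, ← dupNumerator_eq W heq, ← hL, eq_div_iff (pow_ne_zero 2 hψ)]
  ring

end Field

/-! ### §9.2 Local analysis at a prime `ℓ` -/

section Local

variable {ℓ : ℕ} [Fact ℓ.Prime]

/-- `y` is `ℓ`-integral when `x` is (integral equation). [cite: SilvermanAEC2009, VII.2] -/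
theorem norm_y_le_one_of_norm_x_le_one {A₁ A₂ A₃ A₄ A₆ : ℤ} {X Y : ℚ_[ℓ]}
    (heq : Y ^ 2 + A₁ * X * Y + A₃ * Y = X ^ 3 + A₂ * X ^ 2 + A₄ * X + A₆) (hX : ‖X‖ ≤ 1) : ‖Y‖ ≤ 1 := by
  by_contra hY
  rw [not_le] at hY
  have hi := fun n : ℤ => Padic.norm_int_le_one (p := ℓ) n
  have hm : ∀ {u v : ℚ_[ℓ]}, ‖u‖ ≤ 1 → ‖v‖ ≤ 1 → ‖u * v‖ ≤ 1 := fun hu hv => by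
    rw [norm_mul]; exact mul_le_one₀ hu (norm_nonneg _) hv
  have ha : ∀ {u v : ℚ_[ℓ]}, ‖u‖ ≤ 1 → ‖v‖ ≤ 1 → ‖u + v‖ ≤ 1 := fun hu hv =>
    (Padic.nonarchimedean _ _).trans (max_le hu hv)
  have h1 : ‖(A₁ : ℚ_[ℓ]) * X + A₃‖ ≤ 1 := ha (hm (hi _) hX) (hi _)
  have hX2 : ‖X ^ 2‖ ≤ 1 := by rw [norm_pow]; exact pow_le_one₀ (norm_nonneg _) hX
  have hX3 : ‖X ^ 3‖ ≤ 1 := by rw [norm_pow]; exact pow_le_one₀ (norm_nonneg _) hX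
  have hR : ‖X ^ 3 + A₂ * X ^ 2 + A₄ * X + A₆‖ ≤ 1 := ha (ha (ha hX3 (hm (hi _) hX2)) (hm (hi _) hX)) (hi _)
  have hne : ‖Y‖ ≠ ‖(A₁ : ℚ_[ℓ]) * X + A₃‖ := by intro e; rw [← e] at h1; linarith
  have h2 : ‖Y + ((A₁ : ℚ_[ℓ]) * X + A₃)‖ = ‖Y‖ := by
    rw [Padic.add_eq_max_of_ne hne, max_eq_left (h1.trans hY.le)]
  have hL : Y ^ 2 + A₁ * X * Y + A₃ * Y = Y * (Y + ((A₁ : ℚ_[ℓ]) * X + A₃)) := by ring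
  rw [hL] at heq
  have : ‖Y * (Y + ((A₁ : ℚ_[ℓ]) * X + A₃))‖ = ‖Y‖ * ‖Y‖ := by rw [norm_mul, h2]
  rw [heq] at this
  nlinarith

/-- **No prime `ℓ ∤ D` divides both `N` and `M` when `P` reduces non-singularly at `ℓ`**, and no prime `ℓ ∣ D` divides `N`.
Here `x = a/D` in lowest terms, `(N : ℚ) = D⁴·φ₂(x)`, `(M : ℚ) = D⁴·ψ₂²`, and the coefficients are integers `Aᵢ`.
[cite: SilvermanAEC2009, VII.2, Ex. 3.7] -/
theorem not_dvd_of_hasNonsingularReductionAt (V : WeierstrassCurve ℚ) {A₁ A₂ A₃ A₄ A₆ : ℤ}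
    (hA1 : V.a₁ = A₁) (hA2 : V.a₂ = A₂) (hA3 : V.a₃ = A₃) (hA4 : V.a₄ = A₄) (hA6 : V.a₆ = A₆)
    {x y : ℚ} (h : V.toAffine.Nonsingular x y) (hns : V.HasNonsingularReductionAt ℓ x y) {N M : ℤ}
    (hN : (N : ℚ) = (x.den : ℚ) ^ 4 * (x ^ 4 - (2 * A₄ + A₁ * A₃) * x ^ 2 - 2 * (A₃ ^ 2 + 4 * A₆) * x
        - (A₁ ^ 2 * A₆ + 4 * A₂ * A₆ - A₁ * A₃ * A₄ + A₂ * A₃ ^ 2 - A₄ ^ 2)))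
    (hM : (M : ℚ) = (x.den : ℚ) ^ 4 * (2 * y + A₁ * x + A₃) ^ 2)
    (hℓN : (ℓ : ℤ) ∣ N) (hℓM : (ℓ : ℤ) ∣ M) : False := by
  have hℓ : ℓ.Prime := Fact.out
  have heq : y ^ 2 + V.a₁ * x * y + V.a₃ * y = x ^ 3 + V.a₂ * x ^ 2 + V.a₄ * x + V.a₆ :=
    (WeierstrassCurve.Affine.equation_iff ..).mp h.left
  rw [hA1, hA2, hA3, hA4, hA6] at heq
  have ha : (x.num : ℚ) = x * (x.den : ℚ) := (Rat.mul_den_eq_num x).symm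
  by_cases hℓD : (ℓ : ℤ) ∣ (x.den : ℤ)
  · -- `ℓ ∣ D`: then `N ≡ a⁴ (mod D)` forces `ℓ ∣ a`, contradicting `gcd(a, D) = 1`
    have hNint : N = x.num ^ 4 - (x.den : ℤ) * ((2 * A₄ + A₁ * A₃) * x.num ^ 2 * x.den
        + 2 * (A₃ ^ 2 + 4 * A₆) * x.num * (x.den : ℤ) ^ 2
        + (A₁ ^ 2 * A₆ + 4 * A₂ * A₆ - A₁ * A₃ * A₄ + A₂ * A₃ ^ 2 - A₄ ^ 2) * (x.den : ℤ) ^ 3) := by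
      have e : ((N : ℤ) : ℚ) = ((x.num ^ 4 - (x.den : ℤ) * ((2 * A₄ + A₁ * A₃) * x.num ^ 2 * x.den
          + 2 * (A₃ ^ 2 + 4 * A₆) * x.num * (x.den : ℤ) ^ 2
          + (A₁ ^ 2 * A₆ + 4 * A₂ * A₆ - A₁ * A₃ * A₄ + A₂ * A₃ ^ 2 - A₄ ^ 2) * (x.den : ℤ) ^ 3) : ℤ) : ℚ) := by
        push_cast; rw [hN, ha]; ring
      exact_mod_cast e
    have h4 : (ℓ : ℤ) ∣ x.num ^ 4 := by
      have := hℓN.add (hℓD.mul_right ((2 * A₄ + A₁ * A₃) * x.num ^ 2 * x.den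
        + 2 * (A₃ ^ 2 + 4 * A₆) * x.num * (x.den : ℤ) ^ 2
        + (A₁ ^ 2 * A₆ + 4 * A₂ * A₆ - A₁ * A₃ * A₄ + A₂ * A₃ ^ 2 - A₄ ^ 2) * (x.den : ℤ) ^ 3))
      rw [hNint] at this
      simpa using this
    have hp : Prime (ℓ : ℤ) := Nat.prime_iff_prime_int.mp hℓ
    have ha' : ℓ ∣ x.num.natAbs := Int.ofNat_dvd_left.mp (hp.dvd_of_dvd_pow h4)
    have hD' : ℓ ∣ x.den := Int.natCast_dvd_natCast.mp hℓD
    exact hℓ.ne_one ((Nat.Coprime.coprime_dvd_left ha' x.reduced).eq_one_of_dvd hD')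
  · -- `ℓ ∤ D`: work with `ℓ`-adic norms
    set X : ℚ_[ℓ] := (x : ℚ_[ℓ]) with hXdef
    set Y : ℚ_[ℓ] := (y : ℚ_[ℓ]) with hYdef
    have hi := fun n : ℤ => Padic.norm_int_le_one (p := ℓ) n
    have hm : ∀ {u v : ℚ_[ℓ]}, ‖u‖ ≤ 1 → ‖v‖ ≤ 1 → ‖u * v‖ ≤ 1 := fun hu hv => by
      rw [norm_mul]; exact mul_le_one₀ hu (norm_nonneg _) hv
    have hadd : ∀ {u v : ℚ_[ℓ]}, ‖u‖ ≤ 1 → ‖v‖ ≤ 1 → ‖u + v‖ ≤ 1 := fun hu hv =>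
      (Padic.nonarchimedean _ _).trans (max_le hu hv)
    have hsub : ∀ {u v : ℚ_[ℓ]}, ‖u‖ ≤ 1 → ‖v‖ ≤ 1 → ‖u - v‖ ≤ 1 := fun {u v} hu hv => by
      rw [sub_eq_add_neg]; exact hadd hu (by rwa [norm_neg])
    -- `‖D‖_ℓ = 1`
    have hD1 : ‖(x.den : ℚ_[ℓ])‖ = 1 := by
      have hlt : ¬ ‖((x.den : ℤ) : ℚ_[ℓ])‖ < 1 := fun hh => hℓD (Padic.norm_intCast_lt_one_iff.mp hh)
      have hle := hi (x.den : ℤ)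
      push_cast at hlt hle
      exact le_antisymm hle (not_lt.mp hlt)
    -- the equation and the hypotheses, cast into `ℚ_ℓ`
    have heqℓ : Y ^ 2 + (A₁ : ℚ_[ℓ]) * X * Y + A₃ * Y = X ^ 3 + A₂ * X ^ 2 + A₄ * X + A₆ := by
      have := congrArg (Rat.cast : ℚ → ℚ_[ℓ]) heq; push_cast at this; exact this
    have haℓ : X * (x.den : ℚ_[ℓ]) = (x.num : ℚ_[ℓ]) := by
      have := congrArg (Rat.cast : ℚ → ℚ_[ℓ]) (Rat.mul_den_eq_num x); push_cast at this; exact this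
    have hX1 : ‖X‖ ≤ 1 := by
      have : ‖X‖ = ‖(x.num : ℚ_[ℓ])‖ := by rw [← haℓ, norm_mul, hD1, mul_one]
      rw [this]; exact hi _
    have hY1 : ‖Y‖ ≤ 1 := norm_y_le_one_of_norm_x_le_one heqℓ hX1
    -- the two players: `ψ = Φ_y(P)` and `Φ = -Φ_x(P)`
    set ψ : ℚ_[ℓ] := 2 * Y + A₁ * X + A₃ with hψdef
    set Φ : ℚ_[ℓ] := 3 * X ^ 2 + 2 * A₂ * X + A₄ - A₁ * Y with hΦdef
    have h2 : ‖(2 : ℚ_[ℓ])‖ ≤ 1 := by simpa using hi 2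
    have h3 : ‖(3 : ℚ_[ℓ])‖ ≤ 1 := by simpa using hi 3
    have hX2 : ‖X ^ 2‖ ≤ 1 := by rw [norm_pow]; exact pow_le_one₀ (norm_nonneg _) hX1
    have hΦ1 : ‖Φ‖ ≤ 1 := hsub (hadd (hadd (hm h3 hX2) (hm (hm h2 (hi _)) hX1)) (hi _)) (hm (hi _) hY1)
    -- `ℓ ∣ M` ⟹ `‖ψ‖ < 1`
    have hψ : ‖ψ‖ < 1 := by
      have hMℓ : ‖(M : ℚ_[ℓ])‖ < 1 := Padic.norm_intCast_lt_one_iff.mpr hℓM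
      have hMc : (M : ℚ_[ℓ]) = (x.den : ℚ_[ℓ]) ^ 4 * ψ ^ 2 := by
        have := congrArg (Rat.cast : ℚ → ℚ_[ℓ]) hM; push_cast at this; rw [this]
      rw [hMc, norm_mul, norm_pow, hD1, one_pow, one_mul, norm_pow] at hMℓ
      exact (pow_lt_one_iff_of_nonneg (norm_nonneg _) two_ne_zero).mp hMℓ
    -- `ℓ ∣ N` ⟹ `‖Φ² + A₁Φψ − (A₂ + 2X)ψ²‖ < 1`
    have hkey : Φ ^ 2 + A₁ * Φ * ψ - (A₂ + 2 * X) * ψ ^ 2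
        = X ^ 4 - (2 * A₄ + A₁ * A₃) * X ^ 2 - 2 * (A₃ ^ 2 + 4 * A₆) * X
          - (A₁ ^ 2 * A₆ + 4 * A₂ * A₆ - A₁ * A₃ * A₄ + A₂ * A₃ ^ 2 - A₄ ^ 2) := by
      rw [hΦdef, hψdef]; linear_combination (-(8 * X + (A₁ : ℚ_[ℓ]) ^ 2 + 4 * A₂)) * heqℓ
    have hNn : ‖Φ ^ 2 + A₁ * Φ * ψ - (A₂ + 2 * X) * ψ ^ 2‖ < 1 := by
      have hNℓ : ‖(N : ℚ_[ℓ])‖ < 1 := Padic.norm_intCast_lt_one_iff.mpr hℓN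
      have hNc : (N : ℚ_[ℓ]) = (x.den : ℚ_[ℓ]) ^ 4 * (Φ ^ 2 + A₁ * Φ * ψ - (A₂ + 2 * X) * ψ ^ 2) := by
        rw [hkey]; have := congrArg (Rat.cast : ℚ → ℚ_[ℓ]) hN; push_cast at this; rw [this]
      rw [hNc, norm_mul, norm_pow, hD1, one_pow, one_mul] at hNℓ
      exact hNℓ
    -- hence `‖Φ‖ < 1`
    have hΦ : ‖Φ‖ < 1 := by
      have ht : ‖(A₂ + 2 * X) * ψ ^ 2‖ < 1 := by
        rw [norm_mul, norm_pow]
        have h12 : ‖(A₂ : ℚ_[ℓ]) + 2 * X‖ ≤ 1 := hadd (hi _) (hm h2 hX1)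
        have hψ2 : ‖ψ‖ ^ 2 < 1 := (pow_lt_one_iff_of_nonneg (norm_nonneg _) two_ne_zero).mpr hψ
        nlinarith [norm_nonneg ((A₂ : ℚ_[ℓ]) + 2 * X), norm_nonneg ψ, sq_nonneg ‖ψ‖]
      have hs : ‖Φ ^ 2 + A₁ * Φ * ψ‖ < 1 := by
        have e : Φ ^ 2 + A₁ * Φ * ψ = (Φ ^ 2 + A₁ * Φ * ψ - (A₂ + 2 * X) * ψ ^ 2) + (A₂ + 2 * X) * ψ ^ 2 := by ring
        rw [e]
        exact lt_of_le_of_lt (Padic.nonarchimedean _ _) (max_lt hNn ht)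
      by_contra hge
      have hΦeq : ‖Φ‖ = 1 := le_antisymm hΦ1 (not_lt.mp hge)
      have hA1ψ : ‖(A₁ : ℚ_[ℓ]) * ψ‖ < 1 := by
        rw [norm_mul]; nlinarith [hi A₁, norm_nonneg (A₁ : ℚ_[ℓ]), norm_nonneg ψ]
      have hsum : ‖Φ + A₁ * ψ‖ = 1 := by
        rw [Padic.add_eq_max_of_ne (by rw [hΦeq]; exact (ne_of_lt hA1ψ).symm), hΦeq,
          max_eq_left hA1ψ.le]
      have e : Φ ^ 2 + A₁ * Φ * ψ = Φ * (Φ + A₁ * ψ) := by ring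
      rw [e, norm_mul, hΦeq, hsum, one_mul] at hs
      exact lt_irrefl _ hs
    -- contradiction with non-singular reduction at `ℓ`
    rcases hns with hv | ⟨hne, hv⟩ | ⟨hne, hv⟩
    · exact absurd hX1 (not_le.mpr ((one_lt_norm_ratCast_iff ℓ x).mpr hv))
    · have h1 := (norm_ratCast_eq_one_iff ℓ _).mpr ⟨hne, hv⟩
      rw [WeierstrassCurve.Affine.evalEval_polynomialX, hA1, hA2, hA4] at h1
      push_cast at h1
      rw [show (A₁ : ℚ_[ℓ]) * Y - (3 * X ^ 2 + 2 * A₂ * X + A₄) = -Φ by rw [hΦdef]; ring, norm_neg] at h1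
      linarith
    · have h1 := (norm_ratCast_eq_one_iff ℓ _).mpr ⟨hne, hv⟩
      rw [WeierstrassCurve.Affine.evalEval_polynomialY, hA1, hA3] at h1
      push_cast at h1
      rw [show 2 * Y + (A₁ : ℚ_[ℓ]) * X + A₃ = ψ by rw [hψdef]] at h1
      linarith

end Local

/-! ### §9.3 Néron's duplication numerator -/

/-- **Néron's duplication numerator** (typed candidate 54D `NeronDuplicationNumerator`): for a `ℤ`-integral equation `V/ℚ`, a rational
point `P = (x, y)` with non-singular reduction at every prime and `2P = (x′, y′)` affine, writing `x = a/D` in lowest terms,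
`num x′ = a⁴ − b₄a²D² − 2b₆aD³ − b₈D⁴` exactly. [cite: SilvermanAEC2009, III.2.3(d), Ex. 3.7, VII.2] -/
theorem num_two_nsmul_eq_neronNumerator (V : WeierstrassCurve ℚ) [V.IsIntegral ℤ] {x y x' y' : ℚ}
    (h : V.toAffine.Nonsingular x y) (h' : V.toAffine.Nonsingular x' y')
    (hns : ∀ ℓ : ℕ, ℓ.Prime → V.HasNonsingularReductionAt ℓ x y)
    (h2 : (2 : ℕ) • (.some x y h : V.toAffine.Point) = .some x' y' h') :
    (x'.num : ℚ) = (x.num : ℚ) ^ 4 - V.b₄ * (x.num : ℚ) ^ 2 * (x.den : ℚ) ^ 2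
      - 2 * V.b₆ * (x.num : ℚ) * (x.den : ℚ) ^ 3 - V.b₈ * (x.den : ℚ) ^ 4 := by
  -- integer coefficients
  obtain ⟨A₁, hA1⟩ : ∃ A : ℤ, V.a₁ = A := ⟨(WeierstrassCurve.integralModel ℤ V).a₁, by
    rw [← WeierstrassCurve.integralModel_a₁_eq ℤ V]; exact eq_intCast _ _⟩
  obtain ⟨A₂, hA2⟩ : ∃ A : ℤ, V.a₂ = A := ⟨(WeierstrassCurve.integralModel ℤ V).a₂, by
    rw [← WeierstrassCurve.integralModel_a₂_eq ℤ V]; exact eq_intCast _ _⟩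
  obtain ⟨A₃, hA3⟩ : ∃ A : ℤ, V.a₃ = A := ⟨(WeierstrassCurve.integralModel ℤ V).a₃, by
    rw [← WeierstrassCurve.integralModel_a₃_eq ℤ V]; exact eq_intCast _ _⟩
  obtain ⟨A₄, hA4⟩ : ∃ A : ℤ, V.a₄ = A := ⟨(WeierstrassCurve.integralModel ℤ V).a₄, by
    rw [← WeierstrassCurve.integralModel_a₄_eq ℤ V]; exact eq_intCast _ _⟩
  obtain ⟨A₆, hA6⟩ : ∃ A : ℤ, V.a₆ = A := ⟨(WeierstrassCurve.integralModel ℤ V).a₆, by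
    rw [← WeierstrassCurve.integralModel_a₆_eq ℤ V]; exact eq_intCast _ _⟩
  have hb4 : V.b₄ = 2 * A₄ + A₁ * A₃ := by rw [WeierstrassCurve.b₄, hA1, hA3, hA4]
  have hb6 : V.b₆ = A₃ ^ 2 + 4 * A₆ := by rw [WeierstrassCurve.b₆, hA3, hA6]
  have hb8 : V.b₈ = A₁ ^ 2 * A₆ + 4 * A₂ * A₆ - A₁ * A₃ * A₄ + A₂ * A₃ ^ 2 - A₄ ^ 2 := by
    rw [WeierstrassCurve.b₈, hA1, hA2, hA3, hA4, hA6]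
  -- `P ≠ -P` and the duplication formula
  have hy : y ≠ V.toAffine.negY x y := by
    intro hyeq
    rw [two_nsmul, WeierstrassCurve.Affine.Point.add_self_of_Y_eq hyeq] at h2
    cases h2
  have hψ0 : 2 * y + V.a₁ * x + V.a₃ ≠ 0 := by
    intro h0; apply hy; rw [WeierstrassCurve.Affine.negY]; linear_combination h0
  rw [two_nsmul, WeierstrassCurve.Affine.Point.add_self_of_Y_ne hy] at h2
  simp only [WeierstrassCurve.Affine.Point.some.injEq] at h2
  have hx' : x' = (x ^ 4 - V.b₄ * x ^ 2 - 2 * V.b₆ * x - V.b₈) / (2 * y + V.a₁ * x + V.a₃) ^ 2 := by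
    rw [← h2.1]; exact addX_self_eq_div V.toAffine h.left hy
  -- the integers `N`, `M`
  have ha : (x.num : ℚ) = x * (x.den : ℚ) := (Rat.mul_den_eq_num x).symm
  have hD0 : (x.den : ℚ) ≠ 0 := Nat.cast_ne_zero.mpr x.den_nz
  obtain ⟨N, hNdef⟩ : ∃ N : ℤ, N = x.num ^ 4 - (2 * A₄ + A₁ * A₃) * x.num ^ 2 * (x.den : ℤ) ^ 2
      - 2 * (A₃ ^ 2 + 4 * A₆) * x.num * (x.den : ℤ) ^ 3
      - (A₁ ^ 2 * A₆ + 4 * A₂ * A₆ - A₁ * A₃ * A₄ + A₂ * A₃ ^ 2 - A₄ ^ 2) * (x.den : ℤ) ^ 4 := ⟨_, rfl⟩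
  obtain ⟨M, hMdef⟩ : ∃ M : ℤ, M = (x.den : ℤ) * (4 * x.num ^ 3 + (A₁ ^ 2 + 4 * A₂) * x.num ^ 2 * x.den
      + 2 * (2 * A₄ + A₁ * A₃) * x.num * (x.den : ℤ) ^ 2 + (A₃ ^ 2 + 4 * A₆) * (x.den : ℤ) ^ 3) := ⟨_, rfl⟩
  have hN : (N : ℚ) = (x.den : ℚ) ^ 4 * (x ^ 4 - (2 * A₄ + A₁ * A₃) * x ^ 2 - 2 * (A₃ ^ 2 + 4 * A₆) * x
      - (A₁ ^ 2 * A₆ + 4 * A₂ * A₆ - A₁ * A₃ * A₄ + A₂ * A₃ ^ 2 - A₄ ^ 2)) := by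
    rw [hNdef]; push_cast; rw [ha]; ring
  have hM : (M : ℚ) = (x.den : ℚ) ^ 4 * (2 * y + A₁ * x + A₃) ^ 2 := by
    have e := psiTwo_sq_eq V.toAffine h.left
    rw [hA1, hA3] at e
    have e' : ((2 : ℚ) * y + A₁ * x + A₃) ^ 2 = 4 * x ^ 3 + V.b₂ * x ^ 2 + 2 * V.b₄ * x + V.b₆ := e
    rw [e', WeierstrassCurve.b₂, hb4, hb6, hA1, hA2, hMdef]; push_cast; rw [ha]; ring
  -- `x' = N / M`
  have hx'NM : x' = (N : ℚ) / (M : ℚ) := by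
    rw [hx', hN, hM, hb4, hb6, hb8, hA1, hA3, mul_div_mul_left _ _ (pow_ne_zero 4 hD0)]
  -- `M > 0`
  have hM0 : 0 < M := by
    have hψ0' : (2 : ℚ) * y + A₁ * x + A₃ ≠ 0 := by rw [hA1, hA3] at hψ0; exact_mod_cast hψ0
    have : (0 : ℚ) < (M : ℚ) := by
      rw [hM]
      exact mul_pos (pow_pos (Nat.cast_pos.mpr x.den_pos) 4)
        (lt_of_le_of_ne (sq_nonneg _) (Ne.symm (pow_ne_zero 2 hψ0')))
    exact_mod_cast this
  -- `gcd(N, M) = 1`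
  have hcop : Nat.Coprime N.natAbs M.natAbs := by
    refine Nat.coprime_of_dvd fun k hk hkN hkM => ?_
    haveI : Fact k.Prime := ⟨hk⟩
    exact not_dvd_of_hasNonsingularReductionAt V hA1 hA2 hA3 hA4 hA6 h (hns k hk) hN hM
      (Int.ofNat_dvd_left.mpr hkN) (Int.ofNat_dvd_left.mpr hkM)
  -- conclude
  have hnum : x'.num = N := by rw [hx'NM]; exact Rat.num_div_eq_of_coprime hM0 hcop
  rw [hnum, hNdef, hb4, hb6, hb8]
  push_cast
  ring

end NaiveSigmaLogAtTwo

end Summit.BirchSwinnertonDyer.BirchSwinnertonDyer.Theorems
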